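import Literature.AlgebraicGeometry.Frobenioids.FactorizationTransportWeak
import Literature.AlgebraicGeometry.Frobenioids.RlfStructureWeak
import Literature.AnabelianGeometry.EtaleTheta.FrdIVocabularyWeak
import Literature.AnabelianGeometry.EtaleTheta.Discharge.Sec3Remark364
import Literature.AnabelianGeometry.EtaleTheta.TemperedFrobenioidProps
import HarnessLib

/-!
# [EtTh] §3, Remark 3.6.4 (perfection clause) — DISCHARGED for tempered Frobenioids over the WEAK
# vocabulary `treeMonoidVocabWeak`; isomorphism invariance and perfection-stability of `IsPerfFactorialCof`

Mochizuki, *The étale theta function …*, Publ. RIMS **45** (2009), §3, Remark 3.6.4, PRIMS PDF p.79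
(printed 305) [cite: MochizukiEtTh2009, Rmk 3.6.4 p.79]: "it follows from Lemma 3.5 [applied to the
submonoid `Φ ⊆ Φ^{ℝ-log}`] that the respective divisor monoids `Φ^pf`, `Φ^rlf` of `C^pf`, `C^rlf` also
satisfy the conditions of Definition 3.6, (ii). That is to say, the perfection and realification of a
tempered Frobenioids are again tempered Frobenioids."  The statement file `TemperedFrobenioidProps.lean`
(seat abc-iut-L2-t3) records the perfection clause as the named fact `C₀.Remark364` (parametric in the
[FrdI] vocabulary of the realified data `T`); `Discharge/Sec3Remark364(Holds).lean` (this seat) proves it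
for `T` over the PRINTED vocabulary `treeMonoidVocab`.

THIS FILE (abc-iut F-L2d2-1 / F-L2d2-2 repair chain): the same for `T : RealifiedDivisorMonoids
treeMonoidVocabWeak` — perf-factorial := `IsPerfFactorialCof` (weakly perf-factorial with cofinal
perfection, `FrdIVocabularyWeak.lean`), the reading needed at tempered coverings with infinitely many
special-fibre components (`Ÿ`, `Z_∞`):

* `IsPerfFactorialCof.of_mulEquiv`, `IsPerfFactorialCof.perfection`,
  `isPerfFactorialCof_perfSaturation_of_isPerfect` — the [EtTh]-side corollaries of
  `FactorizationTransportWeak.lean` (isomorphism invariance; "`M^pf` is perf-factorial" in the weak sense);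
* `TemperedFrobenioid.isPerfect_ΦRlog_weak`, `remark364_isPerfFactorialCof`,
  `remark364_isMonoprime_bsFld_weak`, and **`Remark364_holds_weak : C₀.Remark364`** (no residual
  hypothesis; clause (3) uses the root-closure field `cnstR_root` exactly as the printed-vocabulary proof).

Proof-only.  Seat abc-iut-L2-d2 (cell abc-iut, node EtTh:Rmk3.6.4 over the weak vocabulary).  HONEST
FRAMING: classical monoid algebra; nothing here bears on [IUTchIII] Cor. 3.12.
-/

namespace Literature.AnabelianGeometry.EtaleTheta

open CategoryTheory Opposite Literature.AlgebraicGeometry.Frobenioids Function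

universe u₀ v₀ u v w

/-! ### `IsPerfFactorialCof` is isomorphism invariant and stable under perfection -/

/-- **`IsPerfFactorialCof` transports along `M ≅ M'`** — so the model instance `PiNat.isPerfFactorialCof`
applies to every divisor monoid isomorphic to `∏_J ℤ≥0`. [cite: MochizukiFrdI2008, Def. 2.4(i) p.47] -/
theorem IsPerfFactorialCof.of_mulEquiv {M M' : Type w} [CommMonoid M] [CommMonoid M'] (e : M ≃* M')
    (h : IsPerfFactorialCof M) : IsPerfFactorialCof M' :=
  h.elim fun hw hcof => ⟨hw.of_mulEquiv e, hw.rlfCofinal_of_mulEquiv e hcof (hw.of_mulEquiv e)⟩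

/-- **`M^pf` is perf-factorial in the weak vocabulary** when `M` is ([FrdI] Def. 2.4 (i) p.48 "one verifies
immediately that `M^pf` … [is] also perf-factorial", weak form with cofinality).
[cite: MochizukiFrdI2008, Def. 2.4(i) p.48] -/
theorem IsPerfFactorialCof.perfection {M : Type w} [CommMonoid M] (h : IsPerfFactorialCof M) :
    IsPerfFactorialCof (Perfection M) :=
  h.elim fun hw hcof => ⟨hw.perfection, hw.rlfCofinal_perfection hcof⟩

/-- The perf-saturation of a weakly-perf-factorial-with-cofinal-perfection submonoid of a PERFECT monoid
is again such (`P^pf ≅ perfSaturation P`). [cite: MochizukiEtTh2009, Rmk 3.6.4 p.79] -/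
theorem isPerfFactorialCof_perfSaturation_of_isPerfect {Q : Type w} [CommMonoid Q] (hQ : IsPerfect Q)
    {P : Submonoid Q} (hP : IsPerfFactorialCof P) : IsPerfFactorialCof ↥(perfSaturation P) := by
  obtain ⟨e⟩ := Lemma35.nonempty_perfection_mulEquiv_perfSaturation hQ P
  exact hP.perfection.of_mulEquiv e

/-! ### Remark 3.6.4 for tempered Frobenioids over `treeMonoidVocabWeak` -/

namespace TemperedFrobenioid

/-- `Φ^{ℝ-log}(A) = Φ₀^ℝ(Y_A)` is perfect — weak vocabulary: it is a weak realification
(`IsRealificationViaWeak`) and the weak `M^rlf` is perfect (`IsPerfFactorialWeak.Rlf.isPerfect`).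
[cite: MochizukiEtTh2009, Def 3.6 p.76] -/
theorem isPerfect_ΦRlog_weak {D₀ : Type u₀} [Category.{v₀} D₀]
    {T : RealifiedDivisorMonoids (D₀ := D₀) treeMonoidVocabWeak.{w}}
    {D : Type u} [Category.{v} D] {VD : FrdICatStub.{u, v, w} D} (C₀ : TemperedFrobenioid T D VD)
    (A : Dᵒᵖ) : IsPerfect (C₀.ΦRlog.obj A) := by
  obtain ⟨h, e, -⟩ := T.isRealification (C₀.baseOp A)
  exact (IsPerfFactorialWeak.Rlf.isPerfect h).of_mulEquiv e.symm

/-- **[EtTh] Remark 3.6.4, perfection clause (2), weak vocabulary**: the perf-saturation of `Φ(A)` in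
`Φ^{ℝ-log}(A)` — the divisor monoid of `C^pf` at `A` — is again perf-factorial in the weak sense
(`IsPerfFactorialCof`). [cite: MochizukiEtTh2009, Rmk 3.6.4 p.79] -/
theorem remark364_isPerfFactorialCof {D₀ : Type u₀} [Category.{v₀} D₀]
    {T : RealifiedDivisorMonoids (D₀ := D₀) treeMonoidVocabWeak.{w}}
    {D : Type u} [Category.{v} D] {VD : FrdICatStub.{u, v, w} D} (C₀ : TemperedFrobenioid T D VD)
    (A : Dᵒᵖ) : IsPerfFactorialCof ↥(perfSaturation (C₀.Φ.carrier A)) :=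
  isPerfFactorialCof_perfSaturation_of_isPerfect (C₀.isPerfect_ΦRlog_weak A) (C₀.isPerfFactorial A)

/-- **[EtTh] Remark 3.6.4, perfection clause (3), weak vocabulary**: the base-field part of `Φ^pf`,
`perfSaturation Φ(A) ∩ ℝ·Φ₀^cnst`, is monoprime (root-closure of `ℝ·Φ₀^cnst` is the field
`RealifiedDivisorMonoids.cnstR_root`; same argument as `remark364_isMonoprime_bsFld_of_rootClosed`).
[cite: MochizukiEtTh2009, Rmk 3.6.4 p.79] -/
theorem remark364_isMonoprime_bsFld_weak {D₀ : Type u₀} [Category.{v₀} D₀]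
    {T : RealifiedDivisorMonoids (D₀ := D₀) treeMonoidVocabWeak.{w}}
    {D : Type u} [Category.{v} D] {VD : FrdICatStub.{u, v, w} D} (C₀ : TemperedFrobenioid T D VD)
    (A : Dᵒᵖ) :
    IsMonoprime ↥(perfSaturation (C₀.Φ.carrier A) ⊓
      (T.cnstR (C₀.baseOp A)).toSubmonoid.comap Algebra.GrothendieckGroup.of) := by
  have hS : ∀ (x : T.ΦR.obj (C₀.baseOp A)) (n : ℕ+),
      x ^ (n : ℕ) ∈ (T.cnstR (C₀.baseOp A)).toSubmonoid.comap Algebra.GrothendieckGroup.of →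
        x ∈ (T.cnstR (C₀.baseOp A)).toSubmonoid.comap Algebra.GrothendieckGroup.of := by
    intro x n hx
    have hx' : Algebra.GrothendieckGroup.of (x ^ (n : ℕ)) ∈ T.cnstR (C₀.baseOp A) := hx
    rw [map_pow] at hx'
    exact T.cnstR_root _ _ n hx'
  have heq := perfSaturation_inf_eq_of_rootClosed (C₀.Φ.carrier A) _ hS
  exact PerfectionPrimes.isMonoprime_of_mulEquiv (MulEquiv.submonoidCongr heq).symm
    (Lemma35.isMonoprime_perfSaturation (C₀.isPerfect_ΦRlog_weak A) (C₀.isMonoprime_bsFld A))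

/-- **[EtTh] Remark 3.6.4 (perfection clause) holds over the weak vocabulary**: abc-iut-L2-t3's named
statement `Remark364`, for every tempered Frobenioid whose realified base data `T` is typed over
`treeMonoidVocabWeak` — `Φ^pf(A)` is group-saturated in `Φ^{ℝ-log}(A)`, perf-factorial
(`IsPerfFactorialCof`), and has monoprime base-field part.  No residual hypothesis.
[cite: MochizukiEtTh2009, Rmk 3.6.4 p.79] -/
theorem Remark364_holds_weak {D₀ : Type u₀} [Category.{v₀} D₀]
    {T : RealifiedDivisorMonoids (D₀ := D₀) treeMonoidVocabWeak.{w}}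
    {D : Type u} [Category.{v} D] {VD : FrdICatStub.{u, v, w} D} (C₀ : TemperedFrobenioid T D VD) :
    C₀.Remark364 := fun A =>
  ⟨Lemma35.isGroupSaturated_perfSaturation _ (C₀.isGroupSaturated A), C₀.remark364_isPerfFactorialCof A,
    C₀.remark364_isMonoprime_bsFld_weak A⟩

end TemperedFrobenioid

end Literature.AnabelianGeometry.EtaleTheta
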